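import Literature.AlgebraicGeometry.HodgeTheory.HardLefschetzNFoldHolds
import HarnessLib

/-!
# Hard Lefschetz for the restriction of a generator of `H²(ℙᴺ(ℂ); ℂ)` to a smooth projective subvariety (proved)

Family `hodge`, layer `Literature/AlgebraicGeometry/HodgeTheory`. For the relative hard Lefschetz
input of Deligne's invariant cycle theorem (C. Voisin, *Hodge Theory and Complex Algebraic Geometry
II*, Thm. 4.15: "`L = c₁(𝓛)`, `𝓛` relatively ample … hard Lefschetz on the fibres") one needs the
hard Lefschetz property of ONE class `η ∈ H²(𝒳(ℂ); ℂ)` restricted to every fibre. This file proves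
the statement on a single smooth projective `X ⊂ ℙᴺ` in the form: **for a class `r₀` spanning
`H²(ℙᴺ(ℂ); ℂ)` (`exists_isRationalClass_forall_eq_smul_projectiveSpace`) and a closed immersion
`ι : X ⟶ ℙᴺ` of a smooth projective `n`-fold, `ι(ℂ)^* r₀` has the hard Lefschetz property in
dimension `n`** (`hasHardLefschetzProperty_map_of_forall_eq_smul`,
`exists_forall_hasHardLefschetzProperty_map`). Proof: verbatim the argument of
`exists_ne_zero_smul_isRationalClass_of_pullback_eq_fubiniStudy` (file `HyperplaneClassRational`):
with a Hodge model `A` of `X`, a natural multiplicative real de Rham family `e` and the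
hyperplane-type class `H` (`A^* H = e[θ_ι] ⊗ 1`), one has `H = r • ι^* c_P` and `c_P = z₁ • r₀` with
`r z₁ ≠ 0` for `n ≥ 1`; `H` is a Kähler class, so it has the hard Lefschetz property (Voisin I Thm.
6.25, the tree's hodge.S14 `Motives.hasHardLefschetzProperty_kaehlerClass_holds` through
`IsKaehlerClassVia.hasHardLefschetzProperty`), which is invariant under non-zero scalars
(`HasHardLefschetzProperty.smul`). For `n = 0` the property is trivial.

No definition and no named fact is introduced (D-0026).

## References

* [VoisinHodgeI2002] C. Voisin, Hodge Theory and Complex Algebraic Geometry I (CUP 2002), Thm. 6.25,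
  Rem. 6.27, Thm. 7.10, §7.1.2, §7.3.2.
* [VoisinHodgeII2003] C. Voisin, Hodge Theory and Complex Algebraic Geometry II (CUP 2003), Thm. 4.15.
* [HatcherAT2002] A. Hatcher, Algebraic Topology (CUP 2002), Thm. 3.19.
-/

noncomputable section

open scoped Manifold ContDiff
open CategoryTheory AlgebraicGeometry

namespace Literature.AlgebraicGeometry.HodgeTheory

section HodgeTheory

open Literature.AlgebraicTopology.SingularHomology Literature.Geometry.Kaehler
open Literature.NumberTheory.Transcendental
open Literature.AlgebraicGeometry.Motives (projectiveSpace ComplexPoints IsSmoothProjective)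
open Literature.AlgebraicGeometry.Motives.AnalytificationKaehler (fubiniStudyPullbackForm)

variable {n : ℕ} {X : Motives.SchemeOver ℂ}

/-- `X^an` is compact for `X` smooth projective (`X` proper, `X(ℂ)` compact, `X^an ≃ₜ X(ℂ)`). Local
copy of `HodgeModel.compactSpace_carrier`. [cite: SerreGAGA1956, §2 n°7 Prop. 6] -/
private theorem compactSpace_carrier₁ (A : HodgeModel n X) (hX : IsSmoothProjective n X) :
    CompactSpace A.carrier := by
  haveI : IsProper X.hom := Motives.IsSmoothProjective.isProper_holds hX
  haveI : CompactSpace (ComplexPoints X) := Motives.compactSpace_algPoints_of_isProper_holds X ℂ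
  exact A.isAnalytification.homeomorph.symm.compactSpace

/-- **`ι(ℂ)^* r₀` has the hard Lefschetz property in dimension `n`** for a closed immersion
`ι : X ⟶ ℙᴺ` of a smooth projective `n`-fold and any class `r₀` spanning `H²(ℙᴺ(ℂ); ℂ)`: `ι^* r₀`
is a non-zero multiple of the hyperplane-type (Kähler) class `H` of `X`, which has the hard Lefschetz
property (Voisin I Thm. 6.25); trivial for `n = 0`.
[cite: VoisinHodgeI2002, Thm. 6.25, Thm. 7.10 and §7.3.2] [cite: VoisinHodgeII2003, Thm. 4.15]
[cite: HatcherAT2002, Thm. 3.19] -/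
theorem hasHardLefschetzProperty_map_of_forall_eq_smul (hX : IsSmoothProjective n X) {N : ℕ}
    (ι : X ⟶ projectiveSpace N ℂ) [IsClosedImmersion ι.left] {r₀ : complexBetti (projectiveSpace N ℂ) 2}
    (hgen : ∀ c : complexBetti (projectiveSpace N ℂ) 2, ∃ z : ℂ, c = z • r₀) :
    HasHardLefschetzProperty
      (singularCohomology.map ℂ ℂ (Motives.AlgPoints.mapContinuous (L := ℂ) ι) 2 r₀) n := by
  -- dimension `0`: only `L⁰ = id` is concerned
  rcases Nat.eq_zero_or_pos n with rfl | hn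
  · intro j k hjk
    obtain ⟨rfl, rfl⟩ : j = 0 ∧ k = 0 := by omega
    exact Function.bijective_id
  -- a Hodge model `A`, a natural multiplicative real family `e`, the hyperplane-type class `H`
  obtain ⟨A⟩ := (nonempty_hodgeModel_holds (n := n) (X := X)).nonempty hX
  obtain ⟨e, he, hem, -⟩ := exists_deRhamIsoFamily_holds A.model
  have hθ := A.fubiniStudyPullbackForm_mem_closedSmoothForms ι
  obtain ⟨H, hH⟩ := A.pullback_surjective 2 (ofRealClass A.carrier 2 (e A.carrier 2
    (deRhamCohomology.mk ⟨fubiniStudyPullbackForm A.model ι A.toComplexPoints, hθ⟩)))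
  -- the projective space, a Hodge model `B` of it with comparison `e_P ⊗ ℂ`
  have hP : IsSmoothProjective N (projectiveSpace N ℂ) := isSmoothProjective_projectiveSpace' N
  have hnN : n ≤ N := le_of_isClosedImmersion_projectiveSpace hX ι
  obtain ⟨B₀⟩ := (nonempty_hodgeModel_holds (n := N) (X := projectiveSpace N ℂ)).nonempty hP
  obtain ⟨eP, heP, -, -⟩ := exists_deRhamIsoFamily_holds B₀.model
  let B : HodgeModel N (projectiveSpace N ℂ) :=
    { B₀ with
      deRham := eP.complexify
      deRham_isNatural := DeRhamIsoFamily.complexify_isNatural heP }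
  -- the Fubini–Study class `c_P` of `ℙᴺ`
  haveI : IsClosedImmersion (𝟙 (projectiveSpace N ℂ) : projectiveSpace N ℂ ⟶ projectiveSpace N ℂ).left :=
    show IsClosedImmersion (𝟙 (projectiveSpace N ℂ).left) from inferInstance
  have hθP := B.fubiniStudyPullbackForm_mem_closedSmoothForms (𝟙 (projectiveSpace N ℂ))
  obtain ⟨cP, hcP⟩ := B.pullback_surjective 2 (ofRealClass B.carrier 2 (eP B.carrier 2
    (deRhamCohomology.mk ⟨fubiniStudyPullbackForm B.model (𝟙 (projectiveSpace N ℂ)) B.toComplexPoints, hθP⟩)))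
  -- (1) `c_P = z₁ • r₀`, `r₀` rational; `ι^* c_P = z₁ • ι^* r₀`
  obtain ⟨z₁, hz₁⟩ := hgen cP
  set H₁ : complexBetti X 2 :=
    singularCohomology.map ℂ ℂ (Motives.AlgPoints.mapContinuous (L := ℂ) ι) 2 cP with hH₁def
  have hH₁ : H₁ = z₁ • singularCohomology.map ℂ ℂ (Motives.AlgPoints.mapContinuous (L := ℂ) ι) 2 r₀ := by
    rw [hH₁def, hz₁, map_smul]
  -- (2) in the induced model: `A^* H₁ = e''[(ι^an)^* θ_P ⊗ 1]`
  have hfan : ContMDiff 𝓘(ℝ, A.model) 𝓘(ℝ, B.model) ∞ (HodgeModel.anMap B A ι) :=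
    HodgeModel.contMDiff_anMap B A ι hX hP
  set wP : complexDeRhamCohomology B.model B.carrier 2 := complexDeRhamCohomology.ofReal B.model B.carrier 2
    (deRhamCohomology.mk ⟨fubiniStudyPullbackForm B.model (𝟙 (projectiveSpace N ℂ)) B.toComplexPoints, hθP⟩) with hwPdef
  have hwc : B.pullback 2 cP = B.deRham B.carrier 2 wP := by
    rw [hcP, hwPdef]
    exact (complexifyFun_ofReal eP 2 _).symm
  have key : A.pullback 2 H₁ =
      HodgeModel.inducedIso B A hnN A.carrier 2 (complexDeRhamCohomology.map A.model hfan 2 wP) := by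
    rw [HodgeModel.inducedIso_apply, ← LinearMap.comp_apply
        (g := complexDeRhamCohomology.map A.model hfan 2),
      ← complexDeRhamCohomology.map_comp hfan (contMDiff_cylFst B A hnN A.carrier),
      B.deRham_isNatural (Cyl B A hnN A.carrier) B.carrier _
        (hfan.comp (contMDiff_cylFst B A hnN A.carrier)) 2 wP,
      ← hwc, ← HodgeModel.map_anMap_pullback]
    change _ = ((singularCohomology.map ℂ ℂ _ 2 ≫ singularCohomology.map ℂ ℂ _ 2).hom _)
    rw [← singularCohomology.map_comp]
    rfl
  -- the pulled-back form is `θ_ι`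
  have hpull : (fubiniStudyPullbackForm B.model (𝟙 (projectiveSpace N ℂ)) B.toComplexPoints).pullback
      𝓘(ℝ, A.model) (HodgeModel.anMap B A ι) = fubiniStudyPullbackForm A.model ι A.toComplexPoints := by
    have h := A.fubiniStudyPullbackForm_pullback_anMap B ι (𝟙 (projectiveSpace N ℂ)) hX hP
    rwa [Category.comp_id] at h
  have hmap : complexDeRhamCohomology.map A.model hfan 2 wP =
      complexDeRhamCohomology.ofReal A.model A.carrier 2
        (deRhamCohomology.mk ⟨fubiniStudyPullbackForm A.model ι A.toComplexPoints, hθ⟩) := by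
    haveI : PullbackFacts 𝓘(ℝ, A.model) A.carrier 𝓘(ℝ, B.model) B.carrier ℝ := PullbackFacts.real_of_complex
    rw [hwPdef, ← complexDeRhamCohomology.ofReal_map, deRhamCohomology.map_mk]
    congr 2
    exact Subtype.ext hpull
  -- (3) rigidity: `e'' = r • (e ⊗ ℂ)` on `H²_dR(X^an; ℂ)`
  haveI : CompactSpace A.carrier := compactSpace_carrier₁ A hX
  obtain ⟨r, hr⟩ := NaturalDeRhamComparisonRigidity_holds A.model A.model (HodgeModel.inducedFamily B A hnN)
    (HodgeModel.isNatural_inducedFamily B A hnN) e.complexify (DeRhamIsoFamily.complexify_isNatural he)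
    A.carrier A.carrier (Homeomorph.refl A.carrier) contMDiff_id contMDiff_id 2
  have hr' : ∀ y : complexDeRhamCohomology A.model A.carrier 2,
      e.complexify A.carrier 2 y = r • HodgeModel.inducedIso B A hnN A.carrier 2 y := by
    intro y
    have h := hr y
    have h1 : (⟨Homeomorph.refl A.carrier, (Homeomorph.refl A.carrier).continuous⟩ : C(A.carrier, A.carrier)) =
        ContinuousMap.id A.carrier := rfl
    have h2 : complexDeRhamCohomology.map A.model
        (contMDiff_id : ContMDiff 𝓘(ℝ, A.model) 𝓘(ℝ, A.model) ∞ (Homeomorph.refl A.carrier)) 2 =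
          LinearMap.id :=
      complexDeRhamCohomology.map_id (E := A.model) (M := A.carrier) 2
    have lhs : singularCohomology.map ℂ ℂ
        (⟨Homeomorph.refl A.carrier, (Homeomorph.refl A.carrier).continuous⟩ : C(A.carrier, A.carrier)) 2
          (e.complexify A.carrier 2 y) = e.complexify A.carrier 2 y := by
      rw [h1, singularCohomology.map_id]
      rfl
    have rhs : HodgeModel.inducedFamily B A hnN A.carrier 2 (complexDeRhamCohomology.map A.model
        (contMDiff_id : ContMDiff 𝓘(ℝ, A.model) 𝓘(ℝ, A.model) ∞ (Homeomorph.refl A.carrier)) 2 y) =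
          HodgeModel.inducedIso B A hnN A.carrier 2 y :=
      congrArg (HodgeModel.inducedIso B A hnN A.carrier 2) (LinearMap.congr_fun h2 y)
    exact lhs.symm.trans (h.trans (congrArg (r • ·) rhs))
  -- `e ⊗ ℂ` of `θ_ι ⊗ 1` is `A^* H`
  have hHc : A.pullback 2 H = e.complexify A.carrier 2 (complexDeRhamCohomology.ofReal A.model A.carrier 2
      (deRhamCohomology.mk ⟨fubiniStudyPullbackForm A.model ι A.toComplexPoints, hθ⟩)) := by
    rw [hH]
    exact (complexifyFun_ofReal e 2 _).symm
  -- hence `A^* H = r • A^* H₁`, `H = r • H₁ = (r z₁) • ι^* r₀`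
  have hHH₁ : H = r • H₁ := by
    apply A.pullback_injective 2
    rw [map_smul, key, hmap, hHc, hr']
  -- `H ≠ 0` (a Kähler class), so `r ≠ 0` and `z₁ ≠ 0`
  have hK : A.IsKaehlerClassVia e H := A.isKaehlerClassVia_of_pullback_eq_fubiniStudyPullbackForm e hX ι hθ hH
  have hH0 : H ≠ 0 := hK.ne_zero hX hn
  have hr0 : r ≠ 0 := by
    rintro rfl
    exact hH0 (by rw [hHH₁, zero_smul])
  have hz0 : z₁ ≠ 0 := by
    rintro rfl
    exact hH0 (by rw [hHH₁, hH₁, zero_smul, smul_zero])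
  -- `H` is Kähler, hence hard Lefschetz; `ι^* r₀ = (r z₁)⁻¹ • H`
  have hHL : HasHardLefschetzProperty H n :=
    hK.hasHardLefschetzProperty hX Motives.hasHardLefschetzProperty_kaehlerClass_holds he hem
  have heq : singularCohomology.map ℂ ℂ (Motives.AlgPoints.mapContinuous (L := ℂ) ι) 2 r₀ = (r * z₁)⁻¹ • H := by
    rw [hHH₁, hH₁, smul_smul, smul_smul, mul_assoc, inv_mul_cancel₀ (mul_ne_zero hr0 hz0), one_smul]
  rw [heq]
  exact HasHardLefschetzProperty.smul hHL (inv_ne_zero (mul_ne_zero hr0 hz0))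

/-- **One class on `ℙᴺ(ℂ)` whose restriction to every smooth projective subvariety has the hard
Lefschetz property** (the relative hard Lefschetz input of Voisin II Thm. 4.15 for projective
families `𝒳 ⊂ S × ℙᴺ`): any class spanning `H²(ℙᴺ(ℂ); ℂ)`.
[cite: VoisinHodgeII2003, Thm. 4.15] [cite: VoisinHodgeI2002, Thm. 6.25] -/
theorem exists_forall_hasHardLefschetzProperty_map (N : ℕ) :
    ∃ r₀ : complexBetti (projectiveSpace N ℂ) 2, ∀ {m : ℕ} {Y : Motives.SchemeOver ℂ}
      (_ : IsSmoothProjective m Y) (κ : Y ⟶ projectiveSpace N ℂ) [IsClosedImmersion κ.left],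
      HasHardLefschetzProperty
        (singularCohomology.map ℂ ℂ (Motives.AlgPoints.mapContinuous (L := ℂ) κ) 2 r₀) m := by
  obtain ⟨r₀, -, hgen⟩ := exists_isRationalClass_forall_eq_smul_projectiveSpace N
  exact ⟨r₀, fun hY κ _ => hasHardLefschetzProperty_map_of_forall_eq_smul hY κ hgen⟩

end HodgeTheory

end Literature.AlgebraicGeometry.HodgeTheory

end
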